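import Literature.MathematicalPhysics.KineticTheory.ReyBelletThomas2002DetCore
import HarnessLib

/-!
# Rey-Bellet–Thomas 2002 with `k₁ < k₂`: rescaling with one exponent, two growth rates

Trunk T-KINETIC (Literature/MathematicalPhysics/KineticTheory). Inline step towards Theorem 3.10 / 2.1
of Rey-Bellet–Thomas, CMP **225** (2002), for the named fact `ReyBelletThomas2002_thm21` in the
regime the printed §3.1 does NOT cover, pinning exponent `k₁` strictly smaller than the interaction
exponent `k₂`: there the single-time-scale compactness argument of Theorem 3.3 fails and one follows
the two-regime repair of Cuneo–Eckmann–Hairer–Rey-Bellet, EJP **23** (2018) §5 (arXiv:1712.09413):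
rescale with the INTERACTION exponent `k₂` when the kinetic+interaction energy dominates (the
pinning forces then vanish in the limit, §5.1) and with the PINNING exponent `k₁` when the pinning
energy dominates (the chain is a "tight molecule" and its centre of mass moves in the limiting
pinning potential, §5.2). This file supplies the common algebra and a-priori bounds:

* `RBGrowth.hasDerivAt_scaledPot'`, `dPotential_rbScaled₂`, `timeScale_smul_rbScale_rbDrift₂`,
  `isIntegralSolutionOn_rbScale₂`, `continuous_rbDriftGen_rbScaled₂` — the rescaling (19)/(20) with
  an ARBITRARY scaling exponent `k` for potentials of growth exponents `k₁, k₂` (exact conjugacy);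
* `OscillatorChain.pinEnergy` / `OscillatorChain.intEnergy` — the split `H = H_int + H_pin`
  (kinetic+interaction / pinning) deciding the regime (CEHR (5.7)), its scaling and translation
  invariance, and `sum_rbForceOf` (the bond forces telescope in the total force);
* `RBGrowth.exists_abs_le_of_scaledPot_le` — `Ũ_E(y) ≤ K ⇒ |y| ≤ B E^{1/k_W - 1/k}` (a potential of
  growth `k_W` rescaled with exponent `k`): positions are `O(E^{1/k₁-1/k₂})` under the interaction
  scaling, bond lengths are `O(E^{1/k₂-1/k₁}) → 0` under the pinning scaling (CEHR (5.12), (5.22));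
* `RBGrowth.eventually_abs_deriv_scaledPot_le_of_lt` — under the interaction scaling the rescaled
  pinning force tends to `0` uniformly on `|y| ≤ B E^{1/k₁-1/k₂}` (CEHR Lemma 5.13, case 2);
* `interaction_scaled_apriori`, `interaction_scaled_drift_bound`, `pinning_scaled_apriori` — the
  a-priori bounds on `{G̃_E ≤ M}` in the two scalings.

## References

* L. Rey-Bellet, L. E. Thomas, Comm. Math. Phys. **225** (2002) 305–329, §3.1 eqs. (18)–(24).
* N. Cuneo, J.-P. Eckmann, M. Hairer, L. Rey-Bellet, Electron. J. Probab. **23** (2018) no. 55,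
  §5 (eqs. (5.7), (5.12), Lemma 5.13, (5.22), Lemma 5.20).
-/

noncomputable section

open MeasureTheory Filter Topology Set intervalIntegral
open scoped NNReal

namespace Literature.MathematicalPhysics.KineticTheory.HeatConduction

open Literature.Analysis.ODE Literature.MathematicalPhysics.KineticTheory

variable {N : ℕ}

/-! ### The rescaled potential for an arbitrary scaling exponent -/

namespace RBGrowth

variable {W : ℝ → ℝ}

/-- `Ũ_E'(y) = E^{1/k-1} W'(E^{1/k} y)` for a differentiable `W` and ANY scaling exponent `k`
(`E > 0`). [cite: ReyBelletThomas2002, §3.1 eq. (20)] -/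
theorem hasDerivAt_scaledPot' (hW : Differentiable ℝ W) (k : ℝ) {E : ℝ} (hE : 0 < E) (y : ℝ) :
    HasDerivAt (scaledPot W k E) (E ^ (1 / k - 1) * deriv W (E ^ (1 / k) * y)) y := by
  set c : ℝ := E ^ (1 / k) with hc
  have h2 : HasDerivAt (fun y : ℝ => c * y) c y := by
    simpa using (hasDerivAt_id y).const_mul c
  have hd : HasDerivAt (fun y => W (c * y)) (deriv W (c * y) * c) y :=
    (hW (c * y)).hasDerivAt.comp y h2
  have hd' : HasDerivAt (scaledPot W k E) (E⁻¹ * (deriv W (c * y) * c)) y := hd.const_mul E⁻¹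
  convert hd' using 1
  rw [hc, Real.rpow_sub hE, Real.rpow_one]
  field_simp

/-- `deriv` form of `hasDerivAt_scaledPot'`. [cite: ReyBelletThomas2002, §3.1 eq. (20)] -/
theorem deriv_scaledPot' (hW : Differentiable ℝ W) (k : ℝ) {E : ℝ} (hE : 0 < E) (y : ℝ) :
    deriv (scaledPot W k E) y = E ^ (1 / k - 1) * deriv W (E ^ (1 / k) * y) :=
  (hasDerivAt_scaledPot' hW k hE y).deriv

/-- The rescaled force is continuous (any scaling exponent). [folklore] -/
theorem continuous_deriv_scaledPot' {kW : ℝ} (hW : RBGrowth W kW) (k : ℝ) {E : ℝ} (hE : 0 < E) :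
    Continuous (deriv (scaledPot W k E)) := by
  have : deriv (scaledPot W k E) = fun y => E ^ (1 / k - 1) * deriv W (E ^ (1 / k) * y) :=
    funext fun y => deriv_scaledPot' hW.differentiable k hE y
  rw [this]
  exact continuous_const.mul (hW.continuous_deriv.comp (continuous_const.mul continuous_id))

/-- **Positions from a bound on the rescaled potential**: for a potential of growth exponent
`k_W > 0` rescaled with an exponent `k > 0`, `Ũ_E(y) = E⁻¹ W(E^{1/k} y) ≤ K` forces
`|y| ≤ B E^{1/k_W - 1/k}` (`E ≥ 1`; `B` depends on `K`). With `k = k_W` this is boundedness; with the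
interaction scaling `k = k₂ > k₁ = k_W` positions may grow like `E^{1/k₁-1/k₂}` (CEHR (5.12)); with
the pinning scaling `k = k₁ < k₂ = k_W` bond lengths are `O(E^{1/k₂-1/k₁}) → 0` (CEHR (5.22)).
[cite: ReyBelletThomas2002, §3.1 (after eq. (19))] -/
theorem exists_abs_le_of_scaledPot_le {kW : ℝ} (hW : RBGrowth W kW) (hkW : 0 < kW) {k : ℝ}
    (hk : 0 < k) (K : ℝ) :
    ∃ B : ℝ, 0 ≤ B ∧ ∀ E : ℝ, 1 ≤ E → ∀ y : ℝ, scaledPot W k E y ≤ K →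
      |y| ≤ B * E ^ (1 / kW - 1 / k) := by
  obtain ⟨C, hC, hWge⟩ := hW.exists_rpow_sub_le hkW
  have ha := hW.coeff_pos
  set K' : ℝ := max K 0 with hK'
  refine ⟨(2 * (K' + C) / hW.coeff) ^ (1 / kW), Real.rpow_nonneg (by positivity) _, fun E hE y hy => ?_⟩
  have hE0 : 0 < E := by linarith
  have h1 := hWge (E ^ (1 / k) * y)
  rw [abs_rpow_mul_rpow hE0] at h1
  -- `W(E^{1/k} y) ≤ K E ≤ K' E`
  have h2 : W (E ^ (1 / k) * y) ≤ E * K' := by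
    have : scaledPot W k E y = E⁻¹ * W (E ^ (1 / k) * y) := rfl
    rw [this] at hy
    have hy' : E⁻¹ * W (E ^ (1 / k) * y) ≤ K' := hy.trans (le_max_left _ _)
    rwa [inv_mul_le_iff₀ hE0] at hy'
  have hK'0 : 0 ≤ K' := le_max_right _ _
  have hCE : C ≤ C * E := le_mul_of_one_le_right hC hE
  have h3 : hW.coeff / 2 * (E ^ (kW / k) * |y| ^ kW) ≤ (K' + C) * E := by nlinarith
  -- divide by `E^{kW/k}`
  have hEp : 0 < E ^ (kW / k) := Real.rpow_pos_of_pos hE0 _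
  have h4a : E ^ (kW / k) * |y| ^ kW ≤ 2 * (K' + C) / hW.coeff * E := by
    rw [div_mul_eq_mul_div, le_div_iff₀ ha]; nlinarith
  have h4 : |y| ^ kW ≤ 2 * (K' + C) / hW.coeff * E ^ (1 - kW / k) := by
    rw [Real.rpow_sub hE0, Real.rpow_one, mul_div_assoc', le_div_iff₀ hEp]
    calc |y| ^ kW * E ^ (kW / k) = E ^ (kW / k) * |y| ^ kW := mul_comm _ _
      _ ≤ _ := h4a
  have h5 := Real.rpow_le_rpow (Real.rpow_nonneg (abs_nonneg y) _) h4 (by positivity : 0 ≤ 1 / kW)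
  rw [← Real.rpow_mul (abs_nonneg y), mul_one_div_cancel hkW.ne', Real.rpow_one,
    Real.mul_rpow (by positivity) (Real.rpow_nonneg hE0.le _), ← Real.rpow_mul hE0.le] at h5
  have hk0 : k ≠ 0 := hk.ne'
  have hkW0 : kW ≠ 0 := hkW.ne'
  have he : (1 - kW / k) * (1 / kW) = 1 / kW - 1 / k := by field_simp
  rwa [he] at h5

/-- **The rescaled pinning force vanishes under the interaction scaling** (CEHR Lemma 5.13, case 2):
for a potential of growth `k₁ ≥ 1` rescaled with an exponent `k₂ > k₁`, uniformly on
`|y| ≤ B E^{1/k₁-1/k₂}`, `|Ũ_E'(y)| = E^{1/k₂-1}|W'(E^{1/k₂}y)| ≤ C(E^{1/k₂-1} + B^{k₁-1}E^{1/k₂-1/k₁}) → 0`.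
[cite: ReyBelletThomas2002, §3.1 eq. (20)] -/
theorem eventually_abs_deriv_scaledPot_le_of_lt {k₁ : ℝ} (hW : RBGrowth W k₁) (hk₁ : 1 ≤ k₁) {k₂ : ℝ}
    (hk : k₁ < k₂) (B : ℝ) {ε : ℝ} (hε : 0 < ε) :
    ∀ᶠ E in atTop, ∀ y : ℝ, |y| ≤ B * E ^ (1 / k₁ - 1 / k₂) →
      |deriv (scaledPot W k₂ E) y| ≤ ε := by
  obtain ⟨C, hC, hWd⟩ := hW.exists_abs_deriv_le hk₁
  have hk₁0 : 0 < k₁ := by linarith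
  have hk₂0 : 0 < k₂ := by linarith
  set B' : ℝ := max B 0 with hB'
  have hB'0 : 0 ≤ B' := le_max_right _ _
  -- the two decaying terms
  have ha : 0 < 1 - 1 / k₂ := by
    rw [sub_pos, div_lt_one hk₂0]; linarith
  have hb : 0 < 1 / k₁ - 1 / k₂ := by
    rw [sub_pos]; exact one_div_lt_one_div_of_lt hk₁0 hk
  have h1 : Tendsto (fun E : ℝ => C * E ^ (-(1 - 1 / k₂))) atTop (𝓝 0) := by
    simpa using (tendsto_rpow_neg_atTop ha).const_mul C
  have h2 : Tendsto (fun E : ℝ => C * B' ^ (k₁ - 1) * E ^ (-(1 / k₁ - 1 / k₂))) atTop (𝓝 0) := by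
    simpa using (tendsto_rpow_neg_atTop hb).const_mul (C * B' ^ (k₁ - 1))
  have h3 := h1.add h2
  rw [add_zero] at h3
  filter_upwards [(tendsto_order.1 h3).2 ε hε, eventually_ge_atTop (1 : ℝ)] with E hEε hE1 y hy
  have hE0 : 0 < E := by linarith
  rw [deriv_scaledPot' hW.differentiable k₂ hE0, abs_mul, abs_of_nonneg (Real.rpow_nonneg hE0.le _)]
  have hz := hWd (E ^ (1 / k₂) * y)
  -- `|E^{1/k₂} y| ≤ B' E^{1/k₁}`
  have hy' : |y| ≤ B' * E ^ (1 / k₁ - 1 / k₂) :=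
    hy.trans (mul_le_mul_of_nonneg_right (le_max_left _ _) (Real.rpow_nonneg hE0.le _))
  have hzle : |E ^ (1 / k₂) * y| ≤ B' * E ^ (1 / k₁) := by
    rw [abs_mul, abs_of_nonneg (Real.rpow_nonneg hE0.le _)]
    calc E ^ (1 / k₂) * |y| ≤ E ^ (1 / k₂) * (B' * E ^ (1 / k₁ - 1 / k₂)) :=
          mul_le_mul_of_nonneg_left hy' (Real.rpow_nonneg hE0.le _)
      _ = B' * (E ^ (1 / k₂) * E ^ (1 / k₁ - 1 / k₂)) := by ring
      _ = B' * E ^ (1 / k₁) := by rw [← Real.rpow_add hE0]; congr 2; ring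
  have hpow : |E ^ (1 / k₂) * y| ^ (k₁ - 1) ≤ (B' * E ^ (1 / k₁)) ^ (k₁ - 1) :=
    Real.rpow_le_rpow (abs_nonneg _) hzle (by linarith)
  have hpow' : (B' * E ^ (1 / k₁)) ^ (k₁ - 1) = B' ^ (k₁ - 1) * E ^ (1 - 1 / k₁) := by
    rw [Real.mul_rpow hB'0 (Real.rpow_nonneg hE0.le _), ← Real.rpow_mul hE0.le]
    congr 2; field_simp
  rw [hpow'] at hpow
  have hE1' : 0 ≤ E ^ (1 / k₂ - 1) := Real.rpow_nonneg hE0.le _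
  have e1 : E ^ (1 / k₂ - 1) = E ^ (-(1 - 1 / k₂)) := by congr 1; ring
  have e2 : E ^ (1 / k₂ - 1) * E ^ (1 - 1 / k₁) = E ^ (-(1 / k₁ - 1 / k₂)) := by
    rw [← Real.rpow_add hE0]; congr 1; ring
  calc E ^ (1 / k₂ - 1) * |deriv W (E ^ (1 / k₂) * y)|
      ≤ E ^ (1 / k₂ - 1) * (C * (1 + B' ^ (k₁ - 1) * E ^ (1 - 1 / k₁))) := by
        refine mul_le_mul_of_nonneg_left (hz.trans ?_) hE1'
        exact mul_le_mul_of_nonneg_left (by linarith) hC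
    _ = C * E ^ (-(1 - 1 / k₂)) + C * B' ^ (k₁ - 1) * E ^ (-(1 / k₁ - 1 / k₂)) := by
        rw [← e1, ← e2]; ring
    _ ≤ ε := hEε.le

/-- **Uniform bound of the rescaled pinning force under the interaction scaling**: for `E ≥ 1`
and `|y| ≤ B E^{1/k₁-1/k₂}` (`1 ≤ k₁ ≤ k₂`), `|Ũ_E'(y)| ≤ C(1 + B^{k₁-1})`.
[cite: ReyBelletThomas2002, §3.1 eq. (20)] -/
theorem exists_forall_abs_deriv_scaledPot_le_of_le {k₁ : ℝ} (hW : RBGrowth W k₁) (hk₁ : 1 ≤ k₁)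
    {k₂ : ℝ} (hk : k₁ ≤ k₂) (B : ℝ) :
    ∃ M : ℝ, 0 ≤ M ∧ ∀ E : ℝ, 1 ≤ E → ∀ y : ℝ, |y| ≤ B * E ^ (1 / k₁ - 1 / k₂) →
      |deriv (scaledPot W k₂ E) y| ≤ M := by
  obtain ⟨C, hC, hWd⟩ := hW.exists_abs_deriv_le hk₁
  have hk₁0 : 0 < k₁ := by linarith
  have hk₂0 : 0 < k₂ := by linarith
  set B' : ℝ := max B 0 with hB'
  have hB'0 : 0 ≤ B' := le_max_right _ _
  refine ⟨C * (1 + B' ^ (k₁ - 1)), by positivity, fun E hE1 y hy => ?_⟩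
  have hE0 : 0 < E := by linarith
  rw [deriv_scaledPot' hW.differentiable k₂ hE0, abs_mul, abs_of_nonneg (Real.rpow_nonneg hE0.le _)]
  have hz := hWd (E ^ (1 / k₂) * y)
  have hy' : |y| ≤ B' * E ^ (1 / k₁ - 1 / k₂) :=
    hy.trans (mul_le_mul_of_nonneg_right (le_max_left _ _) (Real.rpow_nonneg hE0.le _))
  have hzle : |E ^ (1 / k₂) * y| ≤ B' * E ^ (1 / k₁) := by
    rw [abs_mul, abs_of_nonneg (Real.rpow_nonneg hE0.le _)]
    calc E ^ (1 / k₂) * |y| ≤ E ^ (1 / k₂) * (B' * E ^ (1 / k₁ - 1 / k₂)) :=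
          mul_le_mul_of_nonneg_left hy' (Real.rpow_nonneg hE0.le _)
      _ = B' * (E ^ (1 / k₂) * E ^ (1 / k₁ - 1 / k₂)) := by ring
      _ = B' * E ^ (1 / k₁) := by rw [← Real.rpow_add hE0]; congr 2; ring
  have hpow : |E ^ (1 / k₂) * y| ^ (k₁ - 1) ≤ (B' * E ^ (1 / k₁)) ^ (k₁ - 1) :=
    Real.rpow_le_rpow (abs_nonneg _) hzle (by linarith)
  have hpow' : (B' * E ^ (1 / k₁)) ^ (k₁ - 1) = B' ^ (k₁ - 1) * E ^ (1 - 1 / k₁) := by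
    rw [Real.mul_rpow hB'0 (Real.rpow_nonneg hE0.le _), ← Real.rpow_mul hE0.le]
    congr 2; field_simp
  rw [hpow'] at hpow
  have hE1' : 0 ≤ E ^ (1 / k₂ - 1) := Real.rpow_nonneg hE0.le _
  -- both powers of `E` are `≤ 1`
  have hd1 : E ^ (1 / k₂ - 1) ≤ 1 := Real.rpow_le_one_of_one_le_of_nonpos hE1 (by
    have : 1 / k₂ ≤ 1 := by rw [div_le_one hk₂0]; linarith
    linarith)
  have hd2 : E ^ (1 / k₂ - 1) * E ^ (1 - 1 / k₁) ≤ 1 := by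
    rw [← Real.rpow_add hE0]
    refine Real.rpow_le_one_of_one_le_of_nonpos hE1 ?_
    have : 1 / k₂ ≤ 1 / k₁ := one_div_le_one_div_of_le hk₁0 hk
    linarith
  have hBk : 0 ≤ B' ^ (k₁ - 1) := Real.rpow_nonneg hB'0 _
  calc E ^ (1 / k₂ - 1) * |deriv W (E ^ (1 / k₂) * y)|
      ≤ E ^ (1 / k₂ - 1) * (C * (1 + B' ^ (k₁ - 1) * E ^ (1 - 1 / k₁))) := by
        refine mul_le_mul_of_nonneg_left (hz.trans ?_) hE1'
        exact mul_le_mul_of_nonneg_left (by linarith) hC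
    _ = C * E ^ (1 / k₂ - 1) + C * B' ^ (k₁ - 1) * (E ^ (1 / k₂ - 1) * E ^ (1 - 1 / k₁)) := by ring
    _ ≤ C * 1 + C * B' ^ (k₁ - 1) * 1 := by
        gcongr
    _ = C * (1 + B' ^ (k₁ - 1)) := by ring

/-- A potential satisfying H1 rescaled with ANY positive exponent is bounded below uniformly in
`E ≥ 1`: `Ũ_E ≥ -C`. [folklore] -/
theorem exists_neg_le_scaledPot {kW : ℝ} (hW : RBGrowth W kW) (hkW : 0 < kW) (k : ℝ) :
    ∃ C : ℝ, 0 ≤ C ∧ ∀ E : ℝ, 1 ≤ E → ∀ y : ℝ, -C ≤ scaledPot W k E y := by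
  obtain ⟨C, hC, hWge⟩ := hW.exists_rpow_sub_le hkW
  refine ⟨C, hC, fun E hE y => ?_⟩
  have hE0 : 0 < E := by linarith
  have h1 := hWge (E ^ (1 / k) * y)
  have h2 : 0 ≤ hW.coeff / 2 * |E ^ (1 / k) * y| ^ kW := by
    have := hW.coeff_pos; positivity
  have h3 : -C ≤ W (E ^ (1 / k) * y) := by linarith
  show -C ≤ E⁻¹ * W (E ^ (1 / k) * y)
  have hEi : 0 < E⁻¹ := inv_pos.2 hE0
  have hEi1 : E⁻¹ ≤ 1 := inv_le_one_of_one_le₀ hE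
  by_cases hWy : 0 ≤ W (E ^ (1 / k) * y)
  · have : 0 ≤ E⁻¹ * W (E ^ (1 / k) * y) := mul_nonneg hEi.le hWy
    linarith
  · have hWy' : W (E ^ (1 / k) * y) < 0 := not_le.1 hWy
    calc -C = 1 * (-C) := (one_mul _).symm
      _ ≤ E⁻¹ * (-C) := by nlinarith
      _ ≤ E⁻¹ * W (E ^ (1 / k) * y) := mul_le_mul_of_nonneg_left h3 hEi.le

end RBGrowth

/-! ### The scaling algebra with an arbitrary exponent -/

section Algebra

variable {P : OscillatorChain} {k₁ k₂ : ℝ} (hU : RBGrowth P.U k₁) (hV : RBGrowth P.V k₂) (k : ℝ)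
  {E : ℝ} (hE : 0 < E)
include hU hV hE

/-- **The rescaled force** for an arbitrary scaling exponent `k`:
`∇Ṽ_E(E^{-1/k} q) = E^{1/k-1} ∇V(q)`. (Generalizes `dPotential_rbScaled` of
`ReyBelletThomas2002Scaling.lean`, whose hypotheses `RBGrowth P.U k`, `RBGrowth P.V k` tie BOTH
growth exponents to the scaling exponent; here the potentials have growth exponents `k₁, k₂` and the
scaling exponent `k` is free — needed for `k₁ < k₂`.) [cite: ReyBelletThomas2002, §3.1 eq. (20)] -/
theorem dPotential_rbScaled₂ (N : ℕ) (i : Fin N) (q : Fin N → ℝ) :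
    (P.rbScaled k E).dPotential N i (E ^ (-(1 / k)) • q) = E ^ (1 / k - 1) * P.dPotential N i q := by
  rw [OscillatorChain.dPotential_eq_closed, OscillatorChain.dPotential_eq_closed]
  simp only [OscillatorChain.rbScaled_U, OscillatorChain.rbScaled_V, Pi.smul_apply, smul_eq_mul]
  have hsub : ∀ a b : ℝ, E ^ (-(1 / k)) * a - E ^ (-(1 / k)) * b = E ^ (-(1 / k)) * (a - b) :=
    fun a b => by ring
  have hin : ∀ y : ℝ, E ^ (1 / k) * (E ^ (-(1 / k)) * y) = y := fun y => by
    rw [← mul_assoc, ← Real.rpow_add hE, add_neg_cancel, Real.rpow_zero, one_mul]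
  have hdU : ∀ y, deriv (RBGrowth.scaledPot P.U k E) (E ^ (-(1 / k)) * y) = E ^ (1 / k - 1) * deriv P.U y :=
    fun y => by rw [RBGrowth.deriv_scaledPot' hU.differentiable k hE, hin]
  have hdV : ∀ y, deriv (RBGrowth.scaledPot P.V k E) (E ^ (-(1 / k)) * y) = E ^ (1 / k - 1) * deriv P.V y :=
    fun y => by rw [RBGrowth.deriv_scaledPot' hV.differentiable k hE, hin]
  simp only [hsub, hdU, hdV]
  split_ifs <;> ring

/-- **The scaling algebra of the drift** for an arbitrary exponent `k`:
`t_E · L_E(Y(z)) = Ỹ_E(L_E z)`, `Ỹ_E = rbDriftGen (rbScaled P k E) Λ N E^{2/k-1} E^{1/k-1/2}`.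
(Generalizes `timeScale_smul_rbScale_rbDrift`, same conclusion, growth exponents `k₁, k₂` decoupled
from the scaling exponent `k`.) [cite: ReyBelletThomas2002, §3.1 eq. (20)] -/
theorem timeScale_smul_rbScale_rbDrift₂ (Λ : ℝ) (N : ℕ) (z : RBPhaseSpace N) :
    timeScale k E • rbScaleCLM N k E (P.rbDrift Λ N z) =
      (P.rbScaled k E).rbDriftGen Λ N (E ^ (2 / k - 1)) (E ^ (1 / k - 1 / 2)) (rbScaleCLM N k E z) := by
  rw [P.rbDrift_eq hU.differentiable hV.differentiable]
  have hq := timeScale_mul_rpow_neg_inv k hE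
  have hp := timeScale_mul_rpow_neg_half k hE
  have h2 := rpow_two_div_sub_one_mul k hE
  have h3 := rpow_inv_sub_half_mul k hE
  refine Prod.ext (Prod.ext ?_ ?_) (Prod.ext ?_ ?_)
  · funext i
    simp only [rbScaleCLM_apply, OscillatorChain.rbDriftGen, Prod.smul_fst, Pi.smul_apply,
      smul_eq_mul, ← mul_assoc, hq]
  · funext i
    simp only [rbScaleCLM_apply, OscillatorChain.rbDriftGen, Prod.smul_fst, Prod.smul_snd,
      Pi.smul_apply, smul_eq_mul, dPotential_rbScaled₂ hU hV k hE]
    have e1 : timeScale k E * (E ^ (-(1 / 2 : ℝ)) * (-P.dPotential N i z.1.1 -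
        Λ * ((if i.val = 0 then z.2.1 else 0) + (if i.val = N - 1 then z.2.2 else 0)))) =
        -(timeScale k E * E ^ (-(1 / 2 : ℝ))) * P.dPotential N i z.1.1 -
          (timeScale k E * E ^ (-(1 / 2 : ℝ))) * Λ *
            ((if i.val = 0 then z.2.1 else 0) + (if i.val = N - 1 then z.2.2 else 0)) := by ring
    rw [e1, hp]
    have e2 : ∀ c : ℝ, (if i.val = 0 then E ^ (-(1 / k)) * c else 0) =
        E ^ (-(1 / k)) * (if i.val = 0 then c else 0) := fun c => by split_ifs <;> ring
    have e3 : ∀ c : ℝ, (if i.val = N - 1 then E ^ (-(1 / k)) * c else 0) =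
        E ^ (-(1 / k)) * (if i.val = N - 1 then c else 0) := fun c => by split_ifs <;> ring
    simp only [e2, e3]
    rw [← h2]
    ring
  · simp only [rbScaleCLM_apply, OscillatorChain.rbDriftGen, Prod.smul_snd, Prod.smul_fst,
      Pi.smul_apply, smul_eq_mul, Prod.smul_mk, OscillatorChain.rbScaled_γ]
    have e2 : ∀ j : Fin N, (if j.val = 0 then E ^ (-(1 / 2 : ℝ)) * z.1.2 j else 0) =
        E ^ (-(1 / 2 : ℝ)) * (if j.val = 0 then z.1.2 j else 0) := fun j => by split_ifs <;> ring
    simp only [e2, ← Finset.mul_sum]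
    rw [← h3]
    unfold timeScale
    ring
  · simp only [rbScaleCLM_apply, OscillatorChain.rbDriftGen, Prod.smul_snd, Prod.smul_fst,
      Pi.smul_apply, smul_eq_mul, Prod.smul_mk, OscillatorChain.rbScaled_γ]
    have e2 : ∀ j : Fin N, (if j.val = N - 1 then E ^ (-(1 / 2 : ℝ)) * z.1.2 j else 0) =
        E ^ (-(1 / 2 : ℝ)) * (if j.val = N - 1 then z.1.2 j else 0) := fun j => by split_ifs <;> ring
    simp only [e2, ← Finset.mul_sum]
    rw [← h3]
    unfold timeScale
    ring

/-- **Conjugacy of the integral equations under the rescaling (19) with an arbitrary exponent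
`k`**: if `x` solves `x = x₀ + n + ∫ Y(x)` on `[0, T]` then `s ↦ L_E x(t_E s)` solves
`x̃ = L_E x₀ + L_E n(t_E ·) + ∫ Ỹ_E(x̃)` on `[0, T/t_E]`. (Generalizes `isIntegralSolutionOn_rbScale`,
growth exponents `k₁, k₂` decoupled from the scaling exponent `k`.)
[cite: ReyBelletThomas2002, §3.1 eqs. (19)–(20)] -/
theorem isIntegralSolutionOn_rbScale₂ (Λ : ℝ) (N : ℕ) {x n : ℝ → RBPhaseSpace N} {x₀ : RBPhaseSpace N}
    {T : ℝ} (hx : IsIntegralSolutionOn (P.rbDrift Λ N) (fun t => x₀ + n t) x T) (hxc : Continuous x) :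
    IsIntegralSolutionOn ((P.rbScaled k E).rbDriftGen Λ N (E ^ (2 / k - 1)) (E ^ (1 / k - 1 / 2)))
      (fun s => rbScaleCLM N k E x₀ + rbScaleCLM N k E (n (timeScale k E * s)))
      (fun s => rbScaleCLM N k E (x (timeScale k E * s))) (T / timeScale k E) := by
  set L := rbScaleCLM N k E with hL
  set tE := timeScale k E with htE
  have htE0 : 0 < tE := timeScale_pos k hE
  have hYc : Continuous (P.rbDrift Λ N) := (P.contDiff_rbDrift hU.1 hV.1 Λ N).continuous
  intro s hs
  have ht : tE * s ∈ Icc 0 T := by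
    refine ⟨mul_nonneg htE0.le hs.1, ?_⟩
    have := mul_le_mul_of_nonneg_left hs.2 htE0.le
    rwa [mul_div_cancel₀ _ htE0.ne'] at this
  have hxt := hx (tE * s) ht
  have hint : IntervalIntegrable (fun τ => P.rbDrift Λ N (x τ)) volume 0 (tE * s) :=
    (hYc.comp hxc).intervalIntegrable _ _
  have hLint : L (∫ τ in (0 : ℝ)..(tE * s), P.rbDrift Λ N (x τ)) =
      ∫ τ in (0 : ℝ)..(tE * s), L (P.rbDrift Λ N (x τ)) := (L.intervalIntegral_comp_comm hint).symm
  have hsub : ∫ τ in (0 : ℝ)..(tE * s), L (P.rbDrift Λ N (x τ)) =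
      tE • ∫ u in (0 : ℝ)..s, L (P.rbDrift Λ N (x (tE * u))) := by
    have := intervalIntegral.smul_integral_comp_mul_left (f := fun τ => L (P.rbDrift Λ N (x τ)))
      (a := 0) (b := s) tE
    rw [mul_zero] at this
    exact this.symm
  have halg : ∀ u, tE • L (P.rbDrift Λ N (x (tE * u))) =
      (P.rbScaled k E).rbDriftGen Λ N (E ^ (2 / k - 1)) (E ^ (1 / k - 1 / 2)) (L (x (tE * u))) :=
    fun u => timeScale_smul_rbScale_rbDrift₂ hU hV k hE Λ N (x (tE * u))
  calc L (x (tE * s)) = L x₀ + L (n (tE * s)) + L (∫ τ in (0 : ℝ)..(tE * s), P.rbDrift Λ N (x τ)) := by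
        rw [hxt, map_add, map_add]
    _ = L x₀ + L (n (tE * s)) + ∫ u in (0 : ℝ)..s,
          (P.rbScaled k E).rbDriftGen Λ N (E ^ (2 / k - 1)) (E ^ (1 / k - 1 / 2)) (L (x (tE * u))) := by
        rw [hLint, hsub, ← intervalIntegral.integral_smul]
        simp_rw [halg]

/-- The rescaled drift is continuous (any scaling exponent, any reservoir coefficients). [folklore] -/
theorem continuous_rbDriftGen_rbScaled₂ (Λ : ℝ) (N : ℕ) (c_p c_r : ℝ) :
    Continuous ((P.rbScaled k E).rbDriftGen Λ N c_p c_r) := by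
  rw [OscillatorChain.rbDriftGen_eq_rbDriftOf]
  simp only [OscillatorChain.rbScaled_U, OscillatorChain.rbScaled_V, OscillatorChain.rbScaled_γ]
  exact continuous_rbDriftOf (hU.continuous_deriv_scaledPot' k hE) (hV.continuous_deriv_scaledPot' k hE)
    _ _ _ _ _

end Algebra

/-! ### The energy split `H = H_int + H_pin` -/

namespace OscillatorChain

variable (P : OscillatorChain)

/-- The **pinning energy** `H_pin(q) = ∑_i U(q_i)`. [cite: ReyBelletThomas2002, §1 eq. (1)] -/
def pinEnergy (N : ℕ) (q : Fin N → ℝ) : ℝ :=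
  ∑ i, P.U (q i)

/-- The **kinetic + interaction energy** `H_int(q, p) = ∑_i p_i²/2 + ∑_i V(q_{i+1} - q_i)` (the
translation invariant part of `H`; CEHR's `H_i` up to the centre-of-mass kinetic energy).
[cite: ReyBelletThomas2002, §1 eq. (1)] -/
def intEnergy (N : ℕ) (x : PhaseSpace N) : ℝ :=
  (∑ i, x.2 i ^ 2 / 2) + ∑ i : Fin N, ∑ j : Fin N, if j.val = i.val + 1 then P.V (x.1 j - x.1 i) else 0

/-- `H = H_int + H_pin`. [cite: ReyBelletThomas2002, §1 eq. (1)] -/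
theorem hamiltonian_eq_intEnergy_add_pinEnergy (N : ℕ) (x : PhaseSpace N) :
    P.hamiltonian N x = P.intEnergy N x + P.pinEnergy N x.1 := by
  unfold hamiltonian intEnergy pinEnergy
  rw [Finset.sum_add_distrib]
  ring

/-- `G = (r_L² + r_R²)/2 + H_int + H_pin`. [cite: ReyBelletThomas2002, §2 (the energy `G`)] -/
theorem rbEnergy_eq_split (N : ℕ) (x : RBPhaseSpace N) :
    P.rbEnergy N x = (x.2.1 ^ 2 + x.2.2 ^ 2) / 2 + P.intEnergy N x.1 + P.pinEnergy N x.1.1 := by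
  unfold rbEnergy
  rw [hamiltonian_eq_intEnergy_add_pinEnergy]
  ring

/-- `G̃_E = E^{2/k-1}(r̃_L² + r̃_R²)/2 + H̃_int + H̃_pin` for the rescaled data.
[cite: ReyBelletThomas2002, §3.1 (after eq. (19))] -/
theorem rbScaledEnergy_eq_split (k E : ℝ) (N : ℕ) (x : RBPhaseSpace N) :
    P.rbScaledEnergy k E N x = E ^ (2 / k - 1) * ((x.2.1 ^ 2 + x.2.2 ^ 2) / 2) +
      (P.rbScaled k E).intEnergy N x.1 + (P.rbScaled k E).pinEnergy N x.1.1 := by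
  unfold rbScaledEnergy
  rw [hamiltonian_eq_intEnergy_add_pinEnergy]
  ring

/-- The kinetic + interaction energy is translation invariant. [folklore] -/
theorem intEnergy_translate (N : ℕ) (x : PhaseSpace N) (c : ℝ) :
    P.intEnergy N (fun i => x.1 i - c, x.2) = P.intEnergy N x := by
  unfold intEnergy
  simp only [sub_sub_sub_cancel_right]

variable {P}

/-- **Scaling of the pinning energy**: `E · H̃_pin,E(E^{-1/k} q) = H_pin(q)` (`E > 0`).
[cite: ReyBelletThomas2002, §3.1 (after eq. (19))] -/
theorem mul_pinEnergy_rbScaled {k E : ℝ} (hE : 0 < E) (N : ℕ) (q : Fin N → ℝ) :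
    E * (P.rbScaled k E).pinEnergy N (E ^ (-(1 / k)) • q) = P.pinEnergy N q := by
  unfold pinEnergy
  simp only [rbScaled_U, Pi.smul_apply, smul_eq_mul, RBGrowth.scaledPot]
  have hin : ∀ y : ℝ, E ^ (1 / k) * (E ^ (-(1 / k)) * y) = y := fun y => by
    rw [← mul_assoc, ← Real.rpow_add hE, add_neg_cancel, Real.rpow_zero, one_mul]
  simp only [hin]
  rw [Finset.mul_sum]
  refine Finset.sum_congr rfl fun i _ => ?_
  field_simp

/-- **Scaling of the kinetic + interaction energy**: `E · H̃_int,E(L_E z) = H_int(z)` (`E > 0`).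
[cite: ReyBelletThomas2002, §3.1 (after eq. (19))] -/
theorem mul_intEnergy_rbScaled {k E : ℝ} (hE : 0 < E) (N : ℕ) (z : PhaseSpace N) :
    E * (P.rbScaled k E).intEnergy N (E ^ (-(1 / k)) • z.1, E ^ (-(1 / 2 : ℝ)) • z.2) =
      P.intEnergy N z := by
  have h := mul_hamiltonian_rbScaled (P := P) (k := k) hE N z
  rw [hamiltonian_eq_intEnergy_add_pinEnergy, hamiltonian_eq_intEnergy_add_pinEnergy, mul_add] at h
  have hp := mul_pinEnergy_rbScaled (P := P) (k := k) hE N z.1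
  simp only at h
  linarith

/-- **Energy scaling for the split**: `H_int(z) = E · H̃_int,E((L_E z).1)` and
`H_pin(q) = E · H̃_pin,E((L_E z).1.1)`. [cite: ReyBelletThomas2002, §3.1 (after eq. (19))] -/
theorem intEnergy_eq_mul_rbScaled {k E : ℝ} (hE : 0 < E) (N : ℕ) (z : RBPhaseSpace N) :
    P.intEnergy N z.1 = E * (P.rbScaled k E).intEnergy N (rbScaleCLM N k E z).1 ∧
      P.pinEnergy N z.1.1 = E * (P.rbScaled k E).pinEnergy N (rbScaleCLM N k E z).1.1 := by
  simp only [rbScaleCLM_apply]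
  exact ⟨(mul_intEnergy_rbScaled hE N z.1).symm, (mul_pinEnergy_rbScaled hE N z.1.1).symm⟩

/-- **The kinetic + interaction energy of a small point is small**, uniformly in `E ≥ 1`:
`H̃_int,E(z) ≤ N ρ²/2 + N² C_V (1/E + (2ρ)^{k₂})` for `‖z‖ ≤ ρ` (interaction exponent `k₂ > 0`
equal to the scaling exponent). [cite: ReyBelletThomas2002, §3.1 (after eq. (19))] -/
theorem intEnergy_rbScaled_le_of_norm_le {k₂ : ℝ} (hV : RBGrowth P.V k₂) (hk₂ : 0 < k₂) :
    ∃ C_V : ℝ, 0 ≤ C_V ∧ ∀ E : ℝ, 1 ≤ E → ∀ (z : PhaseSpace N) (ρ : ℝ), ‖z‖ ≤ ρ →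
      (P.rbScaled k₂ E).intEnergy N z ≤ N * (ρ ^ 2 / 2) + N * (N * (C_V * (1 / E + (2 * ρ) ^ k₂))) := by
  obtain ⟨CV, hCV, hVle⟩ := hV.scaledPot_le hk₂
  refine ⟨CV, hCV, fun E hE z ρ hz => ?_⟩
  have hE0 : 0 < E := by linarith
  have hρ : 0 ≤ ρ := (norm_nonneg _).trans hz
  have hq : ∀ i, |z.1 i| ≤ ρ := fun i => by
    rw [← Real.norm_eq_abs]; exact ((norm_le_pi_norm z.1 i).trans (norm_fst_le z)).trans hz
  have hp : ∀ i, |z.2 i| ≤ ρ := fun i => by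
    rw [← Real.norm_eq_abs]; exact ((norm_le_pi_norm z.2 i).trans (norm_snd_le z)).trans hz
  have h2 : ∑ i : Fin N, z.2 i ^ 2 / 2 ≤ N * (ρ ^ 2 / 2) := by
    have : ∀ i ∈ (Finset.univ : Finset (Fin N)), z.2 i ^ 2 / 2 ≤ ρ ^ 2 / 2 := fun i _ => by
      have : z.2 i ^ 2 ≤ ρ ^ 2 := by rw [← sq_abs]; exact pow_le_pow_left₀ (abs_nonneg _) (hp i) 2
      linarith
    refine (Finset.sum_le_sum this).trans ?_
    rw [Finset.sum_const, Finset.card_univ, Fintype.card_fin, nsmul_eq_mul]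
  have h3 : ∑ i : Fin N, ∑ j : Fin N, (if j.val = i.val + 1 then (P.rbScaled k₂ E).V (z.1 j - z.1 i) else 0) ≤
      N * (N * (CV * (1 / E + (2 * ρ) ^ k₂))) := by
    have hb0 : 0 ≤ CV * (1 / E + (2 * ρ) ^ k₂) := by positivity
    have : ∀ i ∈ (Finset.univ : Finset (Fin N)), ∑ j : Fin N,
        (if j.val = i.val + 1 then (P.rbScaled k₂ E).V (z.1 j - z.1 i) else 0) ≤
        N * (CV * (1 / E + (2 * ρ) ^ k₂)) := fun i _ => by
      have : ∀ j ∈ (Finset.univ : Finset (Fin N)),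
          (if j.val = i.val + 1 then (P.rbScaled k₂ E).V (z.1 j - z.1 i) else 0) ≤
          CV * (1 / E + (2 * ρ) ^ k₂) := fun j _ => by
        split_ifs
        · simp only [OscillatorChain.rbScaled_V]
          refine (hVle E hE0 _).trans (mul_le_mul_of_nonneg_left ?_ hCV)
          have hd : |z.1 j - z.1 i| ≤ 2 * ρ := (abs_sub _ _).trans (by linarith [hq i, hq j])
          have := Real.rpow_le_rpow (abs_nonneg _) hd hk₂.le
          linarith
        · exact hb0
      refine (Finset.sum_le_sum this).trans ?_
      rw [Finset.sum_const, Finset.card_univ, Fintype.card_fin, nsmul_eq_mul]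
    refine (Finset.sum_le_sum this).trans ?_
    rw [Finset.sum_const, Finset.card_univ, Fintype.card_fin, nsmul_eq_mul]
  unfold OscillatorChain.intEnergy
  linarith

variable (P) in
/-- A bond energy is controlled by the Hamiltonian when the potentials are bounded below:
`V(q_{i+1} - q_i) + N m_U + N² m_V ≤ H(q, p)` (`m_V ≤ 0`). [folklore] -/
theorem bond_le_hamiltonian' {m_U m_V : ℝ} (hmV : m_V ≤ 0)
    (hUb : ∀ y, m_U ≤ P.U y) (hVb : ∀ y, m_V ≤ P.V y) (N : ℕ) (x : PhaseSpace N) (i j : Fin N)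
    (hij : j.val = i.val + 1) :
    P.V (x.1 j - x.1 i) + N * m_U + N ^ 2 * m_V ≤ P.hamiltonian N x := by
  unfold hamiltonian
  have h1 : (N : ℝ) * m_U ≤ ∑ l : Fin N, (x.2 l ^ 2 / 2 + P.U (x.1 l)) := by
    have := Finset.card_nsmul_le_sum (Finset.univ : Finset (Fin N)) (fun l => x.2 l ^ 2 / 2 + P.U (x.1 l)) m_U
      (fun l _ => by nlinarith [hUb (x.1 l), sq_nonneg (x.2 l)])
    rwa [nsmul_eq_mul, Finset.card_univ, Fintype.card_fin] at this
  -- the double sum: the bond `(i, j)` plus `N² - 1` terms `≥ m_V`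
  set f : Fin N → Fin N → ℝ := fun i' j' => if j'.val = i'.val + 1 then P.V (x.1 j' - x.1 i') else 0 with hf
  have hf_ge : ∀ i' j', m_V ≤ f i' j' := fun i' j' => by
    simp only [hf]; split_ifs
    · exact hVb _
    · exact hmV
  have hrow : ∀ i' : Fin N, (N : ℝ) * m_V ≤ ∑ j' : Fin N, f i' j' := fun i' => by
    have := Finset.card_nsmul_le_sum (Finset.univ : Finset (Fin N)) (fun j' => f i' j') m_V
      (fun j' _ => hf_ge i' j')
    rwa [nsmul_eq_mul, Finset.card_univ, Fintype.card_fin] at this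
  have hN1 : 1 ≤ N := by have := i.isLt; omega
  have hcard : ∀ l : Fin N, ((((Finset.univ : Finset (Fin N)).erase l).card : ℕ) : ℝ) = N - 1 := fun l => by
    rw [Finset.card_erase_of_mem (Finset.mem_univ l), Finset.card_univ, Fintype.card_fin,
      Nat.cast_sub hN1, Nat.cast_one]
  have hrowi : P.V (x.1 j - x.1 i) + ((N : ℝ) - 1) * m_V ≤ ∑ j' : Fin N, f i j' := by
    rw [← Finset.add_sum_erase _ _ (Finset.mem_univ j)]
    have hfij : f i j = P.V (x.1 j - x.1 i) := by simp [hf, hij]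
    have h2 : (((Finset.univ : Finset (Fin N)).erase j).card : ℝ) * m_V ≤
        ∑ j' ∈ (Finset.univ : Finset (Fin N)).erase j, f i j' := by
      have := Finset.card_nsmul_le_sum ((Finset.univ : Finset (Fin N)).erase j) (fun j' => f i j') m_V
        (fun j' _ => hf_ge i j')
      rwa [nsmul_eq_mul] at this
    rw [hcard j] at h2
    rw [hfij]; linarith
  have hsum : P.V (x.1 j - x.1 i) + (N : ℝ) ^ 2 * m_V ≤ ∑ i' : Fin N, ∑ j' : Fin N, f i' j' := by
    rw [← Finset.add_sum_erase _ _ (Finset.mem_univ i)]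
    have h2 : (((Finset.univ : Finset (Fin N)).erase i).card : ℝ) * (N * m_V) ≤
        ∑ i' ∈ (Finset.univ : Finset (Fin N)).erase i, ∑ j' : Fin N, f i' j' := by
      have := Finset.card_nsmul_le_sum ((Finset.univ : Finset (Fin N)).erase i)
        (fun i' => ∑ j' : Fin N, f i' j') (N * m_V) (fun i' _ => hrow i')
      rwa [nsmul_eq_mul] at this
    rw [hcard i] at h2
    have e : ((N : ℝ) - 1) * m_V + ((N : ℝ) - 1) * (N * m_V) = (N : ℝ) ^ 2 * m_V - m_V := by ring
    linarith
  simp only [hf] at hsum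
  linarith

end OscillatorChain

/-! ### Telescoping of the bond forces and chains of bounded bonds -/

/-- **The bond forces telescope in the total force**: `∑_i F_i(q) = ∑_i fU(q_i)` (action equals
reaction along each bond; CEHR §5.2: "as the interaction forces cancel out").
[cite: ReyBelletThomas2002, §3.1 eq. (21)] -/
theorem sum_rbForceOf (fU fV : ℝ → ℝ) (N : ℕ) (q : Fin N → ℝ) :
    ∑ i : Fin N, rbForceOf fU fV N i q = ∑ i : Fin N, fU (q i) := by
  -- both bond sums are the sum over the bonds `(j, j+1)` of `fV (q_{j+1} - q_j)`
  have hL : ∀ i : Fin N, (if h : 0 < i.val then fV (q i - q ⟨i.val - 1, by omega⟩) else 0) =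
      ∑ j : Fin N, if i.val = j.val + 1 then fV (q i - q j) else 0 := by
    intro i
    by_cases h : 0 < i.val
    · rw [dif_pos h, Finset.sum_eq_single ⟨i.val - 1, by omega⟩]
      · rw [if_pos (show i.val = (i.val - 1) + 1 by omega)]
      · intro j _ hj
        rw [if_neg]
        intro hij
        exact hj (Fin.ext (show j.val = i.val - 1 by omega))
      · intro h'; exact absurd (Finset.mem_univ _) h'
    · rw [dif_neg h]
      refine (Finset.sum_eq_zero fun j _ => ?_).symm
      rw [if_neg (by omega)]
  have hR : ∀ i : Fin N, (if h : i.val + 1 < N then fV (q ⟨i.val + 1, h⟩ - q i) else 0) =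
      ∑ j : Fin N, if j.val = i.val + 1 then fV (q j - q i) else 0 := by
    intro i
    by_cases h : i.val + 1 < N
    · rw [dif_pos h, Finset.sum_eq_single ⟨i.val + 1, h⟩]
      · rw [if_pos rfl]
      · intro j _ hj
        rw [if_neg]
        intro hij
        exact hj (Fin.ext hij)
      · intro h'; exact absurd (Finset.mem_univ _) h'
    · rw [dif_neg h]
      refine (Finset.sum_eq_zero fun j _ => ?_).symm
      rw [if_neg]
      intro hij
      exact h (hij ▸ j.isLt)
  unfold rbForceOf
  rw [Finset.sum_sub_distrib, Finset.sum_add_distrib]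
  suffices hLR : ∑ i : Fin N, (if h : 0 < i.val then fV (q i - q ⟨i.val - 1, by omega⟩) else 0) =
      ∑ i : Fin N, (if h : i.val + 1 < N then fV (q ⟨i.val + 1, h⟩ - q i) else 0) by
    rw [hLR]; ring
  rw [Finset.sum_congr rfl fun i _ => hL i, Finset.sum_congr rfl fun i _ => hR i, Finset.sum_comm]

/-- **A chain with bounded bonds has bounded extent**: if every bond satisfies
`|q_{i+1} - q_i| ≤ B` then `|q_i - q_j| ≤ 2 N B` for all sites. [folklore] -/
theorem abs_sub_le_of_bonds {q : Fin N → ℝ} {B : ℝ} (hB : 0 ≤ B)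
    (h : ∀ i j : Fin N, j.val = i.val + 1 → |q j - q i| ≤ B) (i j : Fin N) :
    |q i - q j| ≤ 2 * N * B := by
  have hN : 0 < N := by have := i.isLt; omega
  -- distance to site `0`
  have key : ∀ n : ℕ, ∀ (hn : n < N), |q ⟨n, hn⟩ - q ⟨0, hN⟩| ≤ n * B := by
    intro n
    induction n with
    | zero => intro hn; simp
    | succ m ih =>
      intro hn
      have hm : m < N := by omega
      have h1 := ih hm
      have h2 := h ⟨m, hm⟩ ⟨m + 1, hn⟩ rfl
      calc |q ⟨m + 1, hn⟩ - q ⟨0, hN⟩|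
          = |(q ⟨m + 1, hn⟩ - q ⟨m, hm⟩) + (q ⟨m, hm⟩ - q ⟨0, hN⟩)| := by ring_nf
        _ ≤ |q ⟨m + 1, hn⟩ - q ⟨m, hm⟩| + |q ⟨m, hm⟩ - q ⟨0, hN⟩| := abs_add_le _ _
        _ ≤ B + m * B := add_le_add h2 h1
        _ = (m + 1 : ℕ) * B := by push_cast; ring
  have hi := key i.val i.isLt
  have hj := key j.val j.isLt
  have hiN : (i.val : ℝ) * B ≤ N * B := mul_le_mul_of_nonneg_right (by exact_mod_cast i.isLt.le) hB
  have hjN : (j.val : ℝ) * B ≤ N * B := mul_le_mul_of_nonneg_right (by exact_mod_cast j.isLt.le) hB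
  have e : q i - q j = (q ⟨i.val, i.isLt⟩ - q ⟨0, hN⟩) - (q ⟨j.val, j.isLt⟩ - q ⟨0, hN⟩) := by
    simp only [Fin.eta]; ring
  rw [e]
  refine (abs_sub _ _).trans ?_
  linarith

/-- **Translating the positions shifts the pinning force**: the reservoir drift at `x + (c𝟙, 0, 0)`
is the drift with pinning force `fU(· + c)` at `x`. [folklore] -/
theorem rbDriftOf_translate (fU fV : ℝ → ℝ) (γ Λ : ℝ) (N : ℕ) (c_p c_r : ℝ) (x : RBPhaseSpace N) (c : ℝ) :
    rbDriftOf fU fV γ Λ N c_p c_r (((fun i => x.1.1 i + c, x.1.2), x.2) : RBPhaseSpace N) =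
      rbDriftOf (fun y => fU (y + c)) fV γ Λ N c_p c_r x := by
  unfold rbDriftOf rbForceOf
  simp only [add_sub_add_right_eq_sub]

/-! ### A-priori bounds in the two scalings -/

section Apriori

variable {P : OscillatorChain} {k₁ k₂ : ℝ} (hU : RBGrowth P.U k₁) (hV : RBGrowth P.V k₂)
  (hk₁ : 2 ≤ k₁) (hk₁₂ : k₁ ≤ k₂)
include hU hV hk₁ hk₁₂

/-- **A-priori bounds on `{G̃_E ≤ M}` under the interaction scaling** (exponent `k₂`, `E ≥ 1`,
`2 ≤ k₁ ≤ k₂`): bond lengths `|q̃_{i+1} - q̃_i| ≤ B_Δ`, positions `|q̃_i| ≤ B_q E^{1/k₁-1/k₂}`,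
momenta `|p̃_i| ≤ C_p` and `E^{1/k₂-1/2}|r̃_b| ≤ C_r` (CEHR (5.12)).
[cite: ReyBelletThomas2002, §3.1 (after eq. (19))] -/
theorem interaction_scaled_apriori (M : ℝ) : ∃ BΔ Bq C_p C_r : ℝ, 0 ≤ BΔ ∧ 0 ≤ Bq ∧ 0 ≤ C_p ∧ 0 ≤ C_r ∧
    ∀ E : ℝ, 1 ≤ E → ∀ x : RBPhaseSpace N, P.rbScaledEnergy k₂ E N x ≤ M →
      (∀ i j : Fin N, j.val = i.val + 1 → |x.1.1 j - x.1.1 i| ≤ BΔ) ∧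
      (∀ i, |x.1.1 i| ≤ Bq * E ^ (1 / k₁ - 1 / k₂)) ∧ (∀ i, |x.1.2 i| ≤ C_p) ∧
      E ^ (1 / k₂ - 1 / 2) * |x.2.1| ≤ C_r ∧ E ^ (1 / k₂ - 1 / 2) * |x.2.2| ≤ C_r := by
  have hk₁0 : 0 < k₁ := by linarith
  have hk₂0 : 0 < k₂ := by linarith
  obtain ⟨CU, hCU, hUb⟩ := hU.exists_neg_le_scaledPot hk₁0 k₂
  obtain ⟨CV, hCV, hVb⟩ := hV.exists_neg_le_scaledPot hk₂0 k₂
  set K : ℝ := max M 0 + N * CU + N ^ 2 * CV with hK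
  have hK0 : 0 ≤ K := by positivity
  obtain ⟨BΔ, hBΔ, hbond⟩ := hV.exists_abs_le_of_scaledPot_le hk₂0 hk₂0 K
  obtain ⟨Bq, hBq, hpos⟩ := hU.exists_abs_le_of_scaledPot_le hk₁0 hk₂0 (K + CU)
  refine ⟨BΔ, Bq, Real.sqrt (2 * (K + CU)), Real.sqrt (2 * K), hBΔ, hBq, Real.sqrt_nonneg _,
    Real.sqrt_nonneg _, fun E hE x hx => ?_⟩
  have hE0 : 0 < E := by linarith
  have hUb' : ∀ y, -CU ≤ (P.rbScaled k₂ E).U y := fun y => by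
    simp only [OscillatorChain.rbScaled_U]; exact hUb E hE y
  have hVb' : ∀ y, -CV ≤ (P.rbScaled k₂ E).V y := fun y => by
    simp only [OscillatorChain.rbScaled_V]; exact hVb E hE y
  have hr0 : 0 ≤ E ^ (2 / k₂ - 1) * ((x.2.1 ^ 2 + x.2.2 ^ 2) / 2) := by positivity
  have hGdef : P.rbScaledEnergy k₂ E N x = E ^ (2 / k₂ - 1) * ((x.2.1 ^ 2 + x.2.2 ^ 2) / 2) +
      (P.rbScaled k₂ E).hamiltonian N x.1 := rfl
  have hH : (P.rbScaled k₂ E).hamiltonian N x.1 ≤ max M 0 := by linarith [le_max_left M 0]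
  have hkin := (P.rbScaled k₂ E).kinetic_le_hamiltonian (by linarith : -CV ≤ 0) hUb' hVb' N x.1
  have hsum0 : 0 ≤ ∑ i, x.1.2 i ^ 2 / 2 := Finset.sum_nonneg fun i _ => by positivity
  have hHlow : -(N * CU + N ^ 2 * CV) ≤ (P.rbScaled k₂ E).hamiltonian N x.1 := by nlinarith
  refine ⟨fun i j hij => ?_, fun i => ?_, fun i => ?_, ?_, ?_⟩
  · -- bonds
    have h1 := (P.rbScaled k₂ E).bond_le_hamiltonian' (by linarith : -CV ≤ 0)
      hUb' hVb' N x.1 i j hij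
    simp only [OscillatorChain.rbScaled_V] at h1
    have h2 : RBGrowth.scaledPot P.V k₂ E (x.1.1 j - x.1.1 i) ≤ K := by
      rw [hK]; nlinarith [le_max_left M 0, le_max_right M 0]
    have := hbond E hE _ h2
    rwa [sub_self, Real.rpow_zero, mul_one] at this
  · -- positions
    have h1 := (P.rbScaled k₂ E).sq_add_U_le_hamiltonian (by linarith : -CU ≤ 0) (by linarith : -CV ≤ 0)
      hUb' hVb' N x.1 i
    simp only [OscillatorChain.rbScaled_U] at h1
    have hp0 : 0 ≤ x.1.2 i ^ 2 / 2 := by positivity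
    have h2 : RBGrowth.scaledPot P.U k₂ E (x.1.1 i) ≤ K + CU := by
      rw [hK]; nlinarith [le_max_left M 0, le_max_right M 0]
    exact hpos E hE _ h2
  · -- momenta
    have h1 := (P.rbScaled k₂ E).sq_add_U_le_hamiltonian (by linarith : -CU ≤ 0) (by linarith : -CV ≤ 0)
      hUb' hVb' N x.1 i
    have h2 := hUb' (x.1.1 i)
    have h4 : x.1.2 i ^ 2 ≤ 2 * (K + CU) := by rw [hK]; nlinarith [le_max_left M 0, le_max_right M 0]
    calc |x.1.2 i| = Real.sqrt (x.1.2 i ^ 2) := (Real.sqrt_sq_eq_abs _).symm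
      _ ≤ Real.sqrt (2 * (K + CU)) := Real.sqrt_le_sqrt h4
  · have h4 : E ^ (2 / k₂ - 1) * x.2.1 ^ 2 ≤ 2 * K := by
      have : E ^ (2 / k₂ - 1) * x.2.2 ^ 2 ≥ 0 := by positivity
      rw [hK]; nlinarith [le_max_left M 0, le_max_right M 0]
    have hsq : (E ^ (1 / k₂ - 1 / 2) * |x.2.1|) ^ 2 = E ^ (2 / k₂ - 1) * x.2.1 ^ 2 := by
      rw [mul_pow, sq_abs, ← Real.rpow_natCast, ← Real.rpow_mul hE0.le]; norm_num; left; congr 1; ring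
    calc E ^ (1 / k₂ - 1 / 2) * |x.2.1| = Real.sqrt ((E ^ (1 / k₂ - 1 / 2) * |x.2.1|) ^ 2) :=
          (Real.sqrt_sq (by positivity)).symm
      _ ≤ Real.sqrt (2 * K) := Real.sqrt_le_sqrt (by rw [hsq]; exact h4)
  · have h4 : E ^ (2 / k₂ - 1) * x.2.2 ^ 2 ≤ 2 * K := by
      have : E ^ (2 / k₂ - 1) * x.2.1 ^ 2 ≥ 0 := by positivity
      rw [hK]; nlinarith [le_max_left M 0, le_max_right M 0]
    have hsq : (E ^ (1 / k₂ - 1 / 2) * |x.2.2|) ^ 2 = E ^ (2 / k₂ - 1) * x.2.2 ^ 2 := by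
      rw [mul_pow, sq_abs, ← Real.rpow_natCast, ← Real.rpow_mul hE0.le]; norm_num; left; congr 1; ring
    calc E ^ (1 / k₂ - 1 / 2) * |x.2.2| = Real.sqrt ((E ^ (1 / k₂ - 1 / 2) * |x.2.2|) ^ 2) :=
          (Real.sqrt_sq (by positivity)).symm
      _ ≤ Real.sqrt (2 * K) := Real.sqrt_le_sqrt (by rw [hsq]; exact h4)

/-- **A-priori bounds and a uniform bound of the rescaled drift under the interaction scaling**
(exponent `k₂`, `E ≥ 1`, `2 ≤ k₁ ≤ k₂`) on `{G̃_E ≤ M}`: bond lengths, positions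
(`O(E^{1/k₁-1/k₂})`), momenta, `E^{1/k₂-1/2}|r̃|` and `‖Ỹ_E‖` (the pinning force stays bounded
there by `exists_forall_abs_deriv_scaledPot_le_of_le`). [cite: ReyBelletThomas2002, §3.1 eqs. (19)–(20)] -/
theorem interaction_scaled_drift_bound (Λ : ℝ) (M : ℝ) : ∃ BΔ Bq C_p R M₁ : ℝ, 0 ≤ BΔ ∧ 0 ≤ Bq ∧ 0 ≤ C_p ∧
    0 ≤ R ∧ 0 ≤ M₁ ∧
    ∀ E : ℝ, 1 ≤ E → ∀ x : RBPhaseSpace N, P.rbScaledEnergy k₂ E N x ≤ M →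
      (∀ i j : Fin N, j.val = i.val + 1 → |x.1.1 j - x.1.1 i| ≤ BΔ) ∧
      (∀ i, |x.1.1 i| ≤ Bq * E ^ (1 / k₁ - 1 / k₂)) ∧ (∀ i, |x.1.2 i| ≤ C_p) ∧
      E ^ (1 / k₂ - 1 / 2) * |x.2.1| ≤ R ∧ E ^ (1 / k₂ - 1 / 2) * |x.2.2| ≤ R ∧
      ‖(P.rbScaled k₂ E).rbDriftGen Λ N (E ^ (2 / k₂ - 1)) (E ^ (1 / k₂ - 1 / 2)) x‖ ≤ M₁ := by
  obtain ⟨BΔ, Bq, Cp, Cr, hBΔ, hBq, hCp, hCr, hapr⟩ := interaction_scaled_apriori (N := N) hU hV hk₁ hk₁₂ M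
  have hk1 : 1 ≤ k₁ := by linarith
  have hk2 : 1 ≤ k₂ := by linarith
  obtain ⟨MU, hMU, hFU⟩ := hU.exists_forall_abs_deriv_scaledPot_le_of_le hk1 hk₁₂ Bq
  obtain ⟨MV, hMV, hFV⟩ := hV.exists_forall_abs_deriv_scaledPot_le hk2 BΔ
  have hΛ := abs_nonneg Λ
  have hγ := abs_nonneg P.γ
  have hN0 : (0 : ℝ) ≤ N := Nat.cast_nonneg N
  set M₁ : ℝ := Cp + (MU + 2 * MV + 2 * |Λ| * Cr) + (|P.γ| * Cr + |Λ| * (N * Cp)) with hM₁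
  have hx1 : 0 ≤ MU + 2 * MV + 2 * |Λ| * Cr := by positivity
  have hx2 : 0 ≤ |P.γ| * Cr + |Λ| * (N * Cp) := by positivity
  have hM₁0 : 0 ≤ M₁ := by positivity
  have hM₁a : Cp ≤ M₁ := by rw [hM₁]; linarith
  have hM₁b : MU + 2 * MV + |Λ| * (2 * Cr) ≤ M₁ := by rw [hM₁]; linarith
  have hM₁c : |P.γ| * Cr + |Λ| * (N * Cp) ≤ M₁ := by rw [hM₁]; linarith
  refine ⟨BΔ, Bq, Cp, Cr, M₁, hBΔ, hBq, hCp, hCr, hM₁0, fun E hE x hx => ?_⟩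
  obtain ⟨hbond, hq, hp, hr₁, hr₂⟩ := hapr E hE x hx
  refine ⟨hbond, hq, hp, hr₁, hr₂, ?_⟩
  have hE0 : 0 < E := by linarith
  have hexp : E ^ (1 / k₂ - 1 / 2) ≤ 1 := Real.rpow_le_one_of_one_le_of_nonpos hE (by
    have : 1 / k₂ ≤ 1 / 2 := by rw [div_le_div_iff₀ (by linarith) (by norm_num)]; linarith
    linarith)
  have hcp0 : 0 ≤ E ^ (2 / k₂ - 1) := Real.rpow_nonneg hE0.le _
  have hcr0 : 0 ≤ E ^ (1 / k₂ - 1 / 2) := Real.rpow_nonneg hE0.le _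
  have hcp : E ^ (2 / k₂ - 1) = E ^ (1 / k₂ - 1 / 2) * E ^ (1 / k₂ - 1 / 2) := by
    rw [← Real.rpow_add hE0]; congr 1; ring
  have hcpr₁ : E ^ (2 / k₂ - 1) * |x.2.1| ≤ Cr := by
    rw [hcp, mul_assoc]
    exact (mul_le_of_le_one_left (by positivity) hexp).trans hr₁
  have hcpr₂ : E ^ (2 / k₂ - 1) * |x.2.2| ≤ Cr := by
    rw [hcp, mul_assoc]
    exact (mul_le_of_le_one_left (by positivity) hexp).trans hr₂
  -- bond force bounds in the two orientations used by `dPotential_eq_closed`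
  have hbdL : ∀ i : Fin N, ∀ (h : 0 < i.val),
      |deriv (RBGrowth.scaledPot P.V k₂ E) (x.1.1 i - x.1.1 ⟨i.val - 1, by omega⟩)| ≤ MV :=
    fun i h => hFV E hE _ (hbond ⟨i.val - 1, by omega⟩ i (by simp; omega))
  have hbdR : ∀ i : Fin N, ∀ (h : i.val + 1 < N),
      |deriv (RBGrowth.scaledPot P.V k₂ E) (x.1.1 ⟨i.val + 1, h⟩ - x.1.1 i)| ≤ MV :=
    fun i h => hFV E hE _ (hbond i ⟨i.val + 1, h⟩ rfl)
  have hsum : ∀ (c : Fin N → Prop) [DecidablePred c],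
      |∑ i : Fin N, (if c i then x.1.2 i else 0)| ≤ N * Cp := by
    intro c _
    refine (Finset.abs_sum_le_sum_abs _ _).trans ?_
    have : ∀ i ∈ (Finset.univ : Finset (Fin N)), |(if c i then x.1.2 i else 0)| ≤ Cp := fun i _ => by
      split_ifs
      · exact hp i
      · simp [hCp]
    refine (Finset.sum_le_sum this).trans ?_
    simp
  refine norm_rbPhaseSpace_le hM₁0 (fun i => ?_) (fun i => ?_) ?_ ?_
  · simp only [OscillatorChain.rbDriftGen]
    exact (hp i).trans hM₁a
  · simp only [OscillatorChain.rbDriftGen]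
    have hd : |(P.rbScaled k₂ E).dPotential N i x.1.1| ≤ MU + 2 * MV := by
      rw [OscillatorChain.dPotential_eq_closed]
      simp only [OscillatorChain.rbScaled_U, OscillatorChain.rbScaled_V]
      have h1 := hFU E hE _ (hq i)
      have h2 : |(if h : 0 < i.val then deriv (RBGrowth.scaledPot P.V k₂ E) (x.1.1 i - x.1.1 ⟨i.val - 1, by omega⟩) else 0)| ≤ MV := by
        split_ifs with h
        · exact hbdL i h
        · simp [hMV]
      have h3 : |(if h : i.val + 1 < N then deriv (RBGrowth.scaledPot P.V k₂ E) (x.1.1 ⟨i.val + 1, h⟩ - x.1.1 i) else 0)| ≤ MV := by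
        split_ifs with h
        · exact hbdR i h
        · simp [hMV]
      refine (abs_sub _ _).trans ?_
      have := abs_add_le (deriv (RBGrowth.scaledPot P.U k₂ E) (x.1.1 i))
        (if h : 0 < i.val then deriv (RBGrowth.scaledPot P.V k₂ E) (x.1.1 i - x.1.1 ⟨i.val - 1, by omega⟩) else 0)
      linarith
    have hA : E ^ (2 / k₂ - 1) * |(if i.val = 0 then x.2.1 else 0) + (if i.val = N - 1 then x.2.2 else 0)| ≤ 2 * Cr := by
      refine (mul_le_mul_of_nonneg_left (abs_add_le _ _) hcp0).trans ?_
      rw [mul_add]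
      have e1 : E ^ (2 / k₂ - 1) * |(if i.val = 0 then x.2.1 else 0)| ≤ Cr := by
        split_ifs
        · exact hcpr₁
        · simp [hCr]
      have e2 : E ^ (2 / k₂ - 1) * |(if i.val = N - 1 then x.2.2 else 0)| ≤ Cr := by
        split_ifs
        · exact hcpr₂
        · simp [hCr]
      linarith
    refine (abs_sub _ _).trans ?_
    rw [abs_neg, abs_mul, abs_mul, abs_of_nonneg hcp0]
    have : E ^ (2 / k₂ - 1) * |Λ| * |(if i.val = 0 then x.2.1 else 0) + (if i.val = N - 1 then x.2.2 else 0)| ≤ |Λ| * (2 * Cr) := by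
      rw [mul_comm (E ^ (2 / k₂ - 1)) |Λ|, mul_assoc]
      exact mul_le_mul_of_nonneg_left hA hΛ
    linarith
  · simp only [OscillatorChain.rbDriftGen, OscillatorChain.rbScaled_γ]
    refine (abs_add_le _ _).trans ?_
    rw [abs_neg, abs_mul, abs_mul, abs_of_nonneg hcr0, abs_mul]
    have h1 : E ^ (1 / k₂ - 1 / 2) * |P.γ| * |x.2.1| ≤ |P.γ| * Cr := by
      rw [mul_comm (E ^ (1 / k₂ - 1 / 2)) |P.γ|, mul_assoc]
      exact mul_le_mul_of_nonneg_left hr₁ hγ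
    have h2 : |Λ| * |∑ i : Fin N, (if i.val = 0 then x.1.2 i else 0)| ≤ |Λ| * (N * Cp) :=
      mul_le_mul_of_nonneg_left (hsum _) hΛ
    linarith
  · simp only [OscillatorChain.rbDriftGen, OscillatorChain.rbScaled_γ]
    refine (abs_add_le _ _).trans ?_
    rw [abs_neg, abs_mul, abs_mul, abs_of_nonneg hcr0, abs_mul]
    have h1 : E ^ (1 / k₂ - 1 / 2) * |P.γ| * |x.2.2| ≤ |P.γ| * Cr := by
      rw [mul_comm (E ^ (1 / k₂ - 1 / 2)) |P.γ|, mul_assoc]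
      exact mul_le_mul_of_nonneg_left hr₂ hγ
    have h2 : |Λ| * |∑ i : Fin N, (if i.val = N - 1 then x.1.2 i else 0)| ≤ |Λ| * (N * Cp) :=
      mul_le_mul_of_nonneg_left (hsum _) hΛ
    linarith

/-- **A-priori bounds on `{G̃_E ≤ M}` under the pinning scaling** (exponent `k₁`, `E ≥ 1`,
`2 ≤ k₁ ≤ k₂`): positions `|q̃_i| ≤ B`, bond lengths `|q̃_{i+1} - q̃_i| ≤ B_Δ E^{1/k₂-1/k₁}` (the
"tight molecule", CEHR (5.22)), momenta `|p̃_i| ≤ C_p`, `E^{1/k₁-1/2}|r̃_b| ≤ C_r`, and the rescaled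
pinning force `|Ũ_E'(q̃_i)| ≤ M_U`. [cite: ReyBelletThomas2002, §3.1 (after eq. (19))] -/
theorem pinning_scaled_apriori (M : ℝ) : ∃ B BΔ C_p C_r M_U : ℝ, 0 ≤ B ∧ 0 ≤ BΔ ∧ 0 ≤ C_p ∧ 0 ≤ C_r ∧
    0 ≤ M_U ∧ ∀ E : ℝ, 1 ≤ E → ∀ x : RBPhaseSpace N, P.rbScaledEnergy k₁ E N x ≤ M →
      (∀ i, |x.1.1 i| ≤ B) ∧ (∀ i j : Fin N, j.val = i.val + 1 → |x.1.1 j - x.1.1 i| ≤ BΔ * E ^ (1 / k₂ - 1 / k₁)) ∧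
      (∀ i, |x.1.2 i| ≤ C_p) ∧ E ^ (1 / k₁ - 1 / 2) * |x.2.1| ≤ C_r ∧ E ^ (1 / k₁ - 1 / 2) * |x.2.2| ≤ C_r ∧
      (∀ i, |deriv (RBGrowth.scaledPot P.U k₁ E) (x.1.1 i)| ≤ M_U) := by
  have hk₁0 : 0 < k₁ := by linarith
  have hk₂0 : 0 < k₂ := by linarith
  have hk1 : 1 ≤ k₁ := by linarith
  obtain ⟨CU, hCU, hUb⟩ := hU.exists_neg_le_scaledPot hk₁0 k₁
  obtain ⟨CV, hCV, hVb⟩ := hV.exists_neg_le_scaledPot hk₂0 k₁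
  set K : ℝ := max M 0 + N * CU + N ^ 2 * CV with hK
  have hK0 : 0 ≤ K := by positivity
  obtain ⟨BΔ, hBΔ, hbond⟩ := hV.exists_abs_le_of_scaledPot_le hk₂0 hk₁0 K
  obtain ⟨Bq, hBq, hpos⟩ := hU.exists_abs_le_of_scaledPot_le hk₁0 hk₁0 (K + CU)
  obtain ⟨MU, hMU, hFU⟩ := hU.exists_forall_abs_deriv_scaledPot_le hk1 Bq
  refine ⟨Bq, BΔ, Real.sqrt (2 * (K + CU)), Real.sqrt (2 * K), MU, hBq, hBΔ, Real.sqrt_nonneg _,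
    Real.sqrt_nonneg _, hMU, fun E hE x hx => ?_⟩
  have hE0 : 0 < E := by linarith
  have hUb' : ∀ y, -CU ≤ (P.rbScaled k₁ E).U y := fun y => by
    simp only [OscillatorChain.rbScaled_U]; exact hUb E hE y
  have hVb' : ∀ y, -CV ≤ (P.rbScaled k₁ E).V y := fun y => by
    simp only [OscillatorChain.rbScaled_V]; exact hVb E hE y
  have hr0 : 0 ≤ E ^ (2 / k₁ - 1) * ((x.2.1 ^ 2 + x.2.2 ^ 2) / 2) := by positivity
  have hGdef : P.rbScaledEnergy k₁ E N x = E ^ (2 / k₁ - 1) * ((x.2.1 ^ 2 + x.2.2 ^ 2) / 2) +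
      (P.rbScaled k₁ E).hamiltonian N x.1 := rfl
  have hH : (P.rbScaled k₁ E).hamiltonian N x.1 ≤ max M 0 := by linarith [le_max_left M 0]
  have hkin := (P.rbScaled k₁ E).kinetic_le_hamiltonian (by linarith : -CV ≤ 0) hUb' hVb' N x.1
  have hsum0 : 0 ≤ ∑ i, x.1.2 i ^ 2 / 2 := Finset.sum_nonneg fun i _ => by positivity
  have hHlow : -(N * CU + N ^ 2 * CV) ≤ (P.rbScaled k₁ E).hamiltonian N x.1 := by nlinarith
  have hposb : ∀ i, |x.1.1 i| ≤ Bq := fun i => by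
    have h1 := (P.rbScaled k₁ E).sq_add_U_le_hamiltonian (by linarith : -CU ≤ 0) (by linarith : -CV ≤ 0)
      hUb' hVb' N x.1 i
    simp only [OscillatorChain.rbScaled_U] at h1
    have hp0 : 0 ≤ x.1.2 i ^ 2 / 2 := by positivity
    have h2 : RBGrowth.scaledPot P.U k₁ E (x.1.1 i) ≤ K + CU := by
      rw [hK]; nlinarith [le_max_left M 0, le_max_right M 0]
    have := hpos E hE _ h2
    rwa [sub_self, Real.rpow_zero, mul_one] at this
  refine ⟨hposb, fun i j hij => ?_, fun i => ?_, ?_, ?_, fun i => hFU E hE _ (hposb i)⟩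
  · have h1 := (P.rbScaled k₁ E).bond_le_hamiltonian' (by linarith : -CV ≤ 0)
      hUb' hVb' N x.1 i j hij
    simp only [OscillatorChain.rbScaled_V] at h1
    have h2 : RBGrowth.scaledPot P.V k₁ E (x.1.1 j - x.1.1 i) ≤ K := by
      rw [hK]; nlinarith [le_max_left M 0, le_max_right M 0]
    exact hbond E hE _ h2
  · have h1 := (P.rbScaled k₁ E).sq_add_U_le_hamiltonian (by linarith : -CU ≤ 0) (by linarith : -CV ≤ 0)
      hUb' hVb' N x.1 i
    have h2 := hUb' (x.1.1 i)
    have h4 : x.1.2 i ^ 2 ≤ 2 * (K + CU) := by rw [hK]; nlinarith [le_max_left M 0, le_max_right M 0]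
    calc |x.1.2 i| = Real.sqrt (x.1.2 i ^ 2) := (Real.sqrt_sq_eq_abs _).symm
      _ ≤ Real.sqrt (2 * (K + CU)) := Real.sqrt_le_sqrt h4
  · have h4 : E ^ (2 / k₁ - 1) * x.2.1 ^ 2 ≤ 2 * K := by
      have : E ^ (2 / k₁ - 1) * x.2.2 ^ 2 ≥ 0 := by positivity
      rw [hK]; nlinarith [le_max_left M 0, le_max_right M 0]
    have hsq : (E ^ (1 / k₁ - 1 / 2) * |x.2.1|) ^ 2 = E ^ (2 / k₁ - 1) * x.2.1 ^ 2 := by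
      rw [mul_pow, sq_abs, ← Real.rpow_natCast, ← Real.rpow_mul hE0.le]; norm_num; left; congr 1; ring
    calc E ^ (1 / k₁ - 1 / 2) * |x.2.1| = Real.sqrt ((E ^ (1 / k₁ - 1 / 2) * |x.2.1|) ^ 2) :=
          (Real.sqrt_sq (by positivity)).symm
      _ ≤ Real.sqrt (2 * K) := Real.sqrt_le_sqrt (by rw [hsq]; exact h4)
  · have h4 : E ^ (2 / k₁ - 1) * x.2.2 ^ 2 ≤ 2 * K := by
      have : E ^ (2 / k₁ - 1) * x.2.1 ^ 2 ≥ 0 := by positivity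
      rw [hK]; nlinarith [le_max_left M 0, le_max_right M 0]
    have hsq : (E ^ (1 / k₁ - 1 / 2) * |x.2.2|) ^ 2 = E ^ (2 / k₁ - 1) * x.2.2 ^ 2 := by
      rw [mul_pow, sq_abs, ← Real.rpow_natCast, ← Real.rpow_mul hE0.le]; norm_num; left; congr 1; ring
    calc E ^ (1 / k₁ - 1 / 2) * |x.2.2| = Real.sqrt ((E ^ (1 / k₁ - 1 / 2) * |x.2.2|) ^ 2) :=
          (Real.sqrt_sq (by positivity)).symm
      _ ≤ Real.sqrt (2 * K) := Real.sqrt_le_sqrt (by rw [hsq]; exact h4)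

end Apriori

end Literature.MathematicalPhysics.KineticTheory.HeatConduction

end
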